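import Summits.QuantumFields.YangMills.Theorems.BalabanUVNodesN19HybridBeyondTarget

/-!
# BalabanUVNodes ∕ node N20 (NE7b) — WHAT THE WEIGHT FACE CAN ABSORB: at a PINNED key the hybrid binder list pays at most a SUMMABLE
# ACROSS-CLASS TOTAL-VARIATION BUDGET `2(W_K + Wsh_K) + 2·|vol·δ_K|`; an unsummable two-run class-LAW gap kills `HybridNE7` for EVERY
# choice of the six dials `Bad, W, shA, shB, Wsh, δ` — the shell dial cannot rescue

Cell `pub-ymgap` (HUMAN RULING D-0062 Track A ∕ D-0149 ∕ director-ym R399 (3a) second-wave width seats), WIDTH SEAT `pub-ymgap-dag-n20-w4`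
(node n20 = NE7b, seat w4), generation g0, CLAIM-1 ∕ INTENT-1.  Route `Summits/QuantumFields/YangMills/Theses/BalabanUVNodes.lean`, key item K3⁷
`SpineGivenEndpointR13SepCoPH` (stmt-QuantumFields-20544; skeleton of record v5 941dddb108cbaacf, stub 2 `stub_expansion13H` :472, faces
`KeyedRelWeight` :315 (N20), `KeyedShellWeight` :321 (N21), `KeyedCoreEdgeHolderD4` :331 (N19′), pin `PinnedAtLive` :363); filed
`--kind proof --supports … --as helper`.  COUNT-NEUTRAL.  THEOREMS ONLY (0 `def`, 0 `instance`, 0 `sorry`).  ADDITIVE — imports dag-n19-w1's `…N19HybridBeyondTarget`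
(p602850; through it `Spine/NE7/Targets` (`Core`), `T4WeightBudget` (`RelWeightBound`), `T4IndicatorShell` (`ShellWeightBound`), `T4MatchingAssembly` (`HybridNE7`)) BY NAME.

WHY (the located ask).  ym-nodeO idea-3 g8's crux card `Cruxes/SpineGivenEndpointR13SepCoPH/Ideas/window-key-core.md` (evidence on 20544, 2026-08-28T04:42Z)
diagnoses stub 2 as refutable AT ITS PIN under (SAT) ∧ (XG) through dag-n19-w1's guard `N19HybridBeyondTarget.not_coreEdge_of_unsummable_gap`
(two good classes whose core log-ratios differ by an unsummable `g_K`), kernel caricature `WindowKeyCoreSketch.caricature_not_coreEdge`.  CRIT-1 g4's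
triage (`…/CRIT-1-TRIAGE-window-key-core.md` §A (3)(iii), Recommendation (b), 04:52Z) objects that the guard is stated with the weights AND THE SHELLS
FIXED while the shell split `sh` (and the bad class, the constants `c_K`, the radius `δ`) are the PROVER's dials, and that the caricature has no shells:
«before "no supplier can serve stub 2 at its pin" stands, cdisprove must show the extensive old-large-field contrast cannot be moved into shells that
still pay `KeyedShellWeight`» — addressed to «cdisprove ∕ dag-n20 lanes».  This file is the kernel answer to the SHELL half (the (XG) half — whether
`D₀ ≠ 0` at the record's `weightA₁₃ ∕ weightB₁₃` — is NOT decided here).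

THE ONE NEW THING.  Read the two runs' term weights at level `K` and source `t` as LAWS ON THE CLASS INDEX: `p(S) = Σ_{τ∈S} A ∕ Σ_T A`,
`q(S) = Σ_{τ∈S} B ∕ Σ_T B` for `S ⊆ T K`.  If `HybridNE7 l₀ vol T A B Bad W shA shB Wsh δ` holds — NE7b's bad-class budget `W`, NE7c's shell budget
`Wsh`, `W + Wsh < 1`, and N19′'s one-constant core sandwich at radius `vol·δ` — then for EVERY `S ⊆ T K`
  `|p(S) − q(S)| ≤ 2·(W_K + Wsh_K) + 2·|vol·δ_K|`      (§2 `abs_classLaw_sub_classLaw_le_of_hybridNE7`),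
a budget that is SUMMABLE over `K` for every admissible choice of the dials.  Mechanism (§1, one line): with `G = T∖Bad`, `η = W + Wsh`, `x = |vol·δ|`,
`Σ_S B ≥ Σ_{S∩G}(B − shB) ≥ e^{c−x}·Σ_{S∩G}(A − shA) ≥ e^{c−x}(Σ_S A − η·Σ_T A)`, the same with the runs exchanged, and the totals pin
`e^{c+x}·Σ_T A ≥ (1 − η)·Σ_T B`; so `q(S) ≥ (1 − η)e^{−2x}(p(S) − η)` and `p(S) − q(S) ≤ 2η + 2x` (§0); the complement `T∖S` gives the other sign.
CONSEQUENCE (§3, the disprover's handle WITH EVERY DIAL FREE): if at the key `(T, A, B)` some admissible source values `t_K` and subsets `S_K ⊆ T K`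
have `|p(S_K) − q(S_K)| ≥ g_K ≥ 0` with `g` NOT summable (e.g. not tending to `0`), then there are NO `Bad, W, shA, shB, Wsh, δ` whatsoever with
`HybridNE7 …` (★★ `not_exists_hybridNE7_of_unsummable_classLawGap`, eventual form `…_of_eventually_classLawGap`); at fixed admissible weights and shells
the N19′ slot `∃ δ, Core … (A − shA) (B − shB) δ ∧ Summable δ` fails (`not_coreEdge_of_unsummable_classLawGap`).  dag-n19-w1's §6 is the
two-point, weights-and-shells-fixed shadow of this: a log-ratio gap between two good classes of comparable mass is a class-law gap; a log-ratio gap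
carried by classes of negligible mass is NOT — those the bad class or the shells absorb, exactly up to the budget.
§4 THE CARD's CARICATURE WITH EVERY DIAL FREE (★★ `caricature_not_hybridNE7_allDials`): classes `v ∈ {0, …, n_K}` (old-large-field counts), run-A
weights `≡ 1`, run-B weights `e^{c_K + D·v}`, `D > 0`, `n_K → ∞` (physically `n_K = vol·L^{4(K₀+K−1)}`): the top class `{n_K}` has `p = 1∕(n_K+1) → 0`
and `q ≥ 1 − e^{−D}` (§4 `one_sub_exp_neg_mul_sum_le_last`), a class-law gap eventually `≥ (1 − e^{−D})∕2`, so NO bad class, NO weight budget, NO shell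
split, NO shell budget, NO constants and NO radius give `HybridNE7` at that reading — the caricature's kill survives the shell dial (`n_K → ∞` is a
convenience of the test set `{n_K}` used here; the class-law gap is positive for every `n_K ≥ 1` and fixed `D`, not typed — the sketch's §1 used `n_K ≥ 1`).

READING (for the plan ∕ CRIT-1 ∕ cdisprove; located, nothing proposed).  (i) At a PINNED key — v5's `PinnedAtLive` pins `(T, A, B)` to
`classSet₁₃ ∕ weightA₁₃ ∕ weightB₁₃` of `crOfRecord₁₃V` on the live line — the six dials of stub 2's four faces buy EXACTLY a summable across-class TV
budget; the faces are jointly refutable at the pin by any unsummable two-run class-LAW contrast, shells included.  So CRIT-1's proviso (3)(iii) «shells?»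
is CLOSED in the diagnosis; what remains conditional is (SAT) and (XG) — and (XG) must be read MASS-WEIGHTED: not «two keys with an extensive log-ratio
gap» but «two runs' normalised class laws TV-far» (in the independent-block product picture with single-block large-field probabilities `ε_A ≠ ε_B` of
fixed relative contrast and `n_K·ε → ∞`, the binomial class laws ARE TV-far — not typed here).  (ii) Conversely the budget says what N20's weight face is
FOR at a pinned key: together with N21's shells it pays for the part of the two-run class-law discrepancy carried by little mass — nothing else;
dag-n19-w1's `…N19CutTransferAtSpineReading` (bad ↦ shells fold, `W ↦ 0`, `Wsh ↦ W + Wsh`) is consistent: the budget reads `W + Wsh` only.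
ADJACENT (dag-lead DEDUP-382: GO both, cite): sibling dag-n20-w5 g0's `…N20QuantisedRatioNoRescue` (CLAIM 05:05Z) kills every dial from a STRUCTURAL
reading — `D`-quantised log-ratio along the class label + anti-concentration of the run-A law — via the two-sided misfit; this file's currency is the
class-law gap on an arbitrary set of classes (no quantisation, no label); neither is cited as subsuming the other.

HONEST FRAMING.  [folklore] finite-sum ∕ real arithmetic on the tree's SHAPES (`HybridNE7`, `RelWeightBound`, `ShellWeightBound`, `Core` occur as
HYPOTHESES only); NO estimate of the programme is proved; nothing of Bałaban's is asserted or instantiated (no `Provisos₁₃CoPH` tuple, no reading of record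
is touched — K0⁷ OPEN); (SAT) ∕ (XG) UNDECIDED, so this is NOT a refutation of stub 2 — it closes one proviso of a CONDITIONAL diagnosis; NE7 ∕ NE7b ∕ NE7c
NOT PRINTED as two-run statements for d = 4 ([Balaban1987RG1]–[Balaban1989LargeFieldII] bound ONE run; [King1986] (3.10)–(3.13) is a d = 2, 3 template)
and NOT proved; N19 ∕ N20 ∕ N21 NOT discharged; K3⁷ OPEN, not claimed; no summit statement is proved by this seat; counts UNMOVED (typed 28∕28 · discharged
5∕27, A 5∕28).  One finite four-torus programme at fixed ε — NOT ℝ⁴, NOT infinite volume, NOT OS, NOT a mass gap, NOT the Clay problem (R4 closes the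
conditional finite-𝕋⁴ rung `BalabanLadder.UV` only).  0 `def`; 0 `sorry`; standard axioms; no decl carries a cite tag.
-/

noncomputable section

namespace Summit.QuantumFields.YangMills.BalabanUVNodes.N20HybridClassLawBudget

open Finset Filter
open Summit.QuantumFields.BalabanUV.T4Continuum.Spine.NE7 (Core)
open Literature.MathematicalPhysics.QuantumFieldTheory.Balaban1983to89
open T4WeightBudget (RelWeightBound)
open T4IndicatorShell (ShellWeightBound)
open T4MatchingAssembly (HybridNE7)

/-! ## §0 Two lines of real arithmetic [folklore] -/

section Arith
/-- `0 ≤ η ≤ 1`, `0 ≤ x` ⇒ `1 − (1 − η)·e^{−2x} ≤ η + 2x` (from `1 − 2x ≤ e^{−2x}`). [folklore] -/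
theorem one_sub_mul_exp_neg_le {η x : ℝ} (hη : 0 ≤ η) (hη1 : η ≤ 1) (hx : 0 ≤ x) :
    1 - (1 - η) * Real.exp (-(2 * x)) ≤ η + 2 * x := by
  have h1 : 1 - 2 * x ≤ Real.exp (-(2 * x)) := by
    have := Real.add_one_le_exp (-(2 * x))
    linarith
  have h2 : (1 - η) * (1 - 2 * x) ≤ (1 - η) * Real.exp (-(2 * x)) :=
    mul_le_mul_of_nonneg_left h1 (sub_nonneg.2 hη1)
  nlinarith [mul_nonneg hη hx]

/-- The budget arithmetic: `m·(p − η) ≤ q`, `p ≤ 1`, `m ≤ 1`, `0 ≤ η`, `1 − m ≤ η + 2x` ⇒ `p − q ≤ 2η + 2x`. [folklore] -/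
theorem sub_le_budget_of_mul_sub_le {p q m η x : ℝ} (hq : m * (p - η) ≤ q) (hp1 : p ≤ 1) (hm1 : m ≤ 1)
    (hη : 0 ≤ η) (h1m : 1 - m ≤ η + 2 * x) : p - q ≤ 2 * η + 2 * x := by
  nlinarith [mul_nonneg (sub_nonneg.2 hm1) (sub_nonneg.2 hp1), mul_nonneg hη (sub_nonneg.2 hm1)]

end Arith
variable {ι : Type*} {l₀ vol : ℝ} {T : ℕ → Finset ι} {A B shA shB : ℕ → ℝ → ι → ℝ} {Bad : ℕ → ℝ → Finset ι} {W Wsh δ : ℕ → ℝ}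

/-! ## §1 One source value, one direction: the bad class and the shells cost `(W_K + Wsh_K)·Σ_T A`, the core sandwich transports the rest [folklore] -/

section OneStep
variable [DecidableEq ι]
/-- **ONE-SIDED TRANSPORT** [folklore].  At one `(K, t)`: nonnegative run-A terms with a bad class of relative weight `≤ W_K`, nonnegative shells
`shA` of total relative weight `≤ Wsh_K`, run-B shells `0 ≤ shB ≤ B`, and on the GOOD classes a lower core bound `m·(A − shA) ≤ B − shB` with `m ≥ 0`
⇒ for EVERY `S ⊆ T K`, `m·(Σ_S A − (W_K + Wsh_K)·Σ_T A) ≤ Σ_S B`.  (`Σ_S B ≥ Σ_{S∖Bad}(B − shB) ≥ m·Σ_{S∖Bad}(A − shA)` and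
`Σ_{S∖Bad}(A − shA) ≥ Σ_S A − Σ_{Bad} A − Σ_T shA`.) -/
theorem mul_sub_le_sum_of_goodCores {K : ℕ} {t : ℝ} {m : ℝ} (hm : 0 ≤ m) {S : Finset ι} (hS : S ⊆ T K) (hBad : Bad K t ⊆ T K)
    (hA : ∀ τ ∈ T K, 0 ≤ A K t τ) (hshA : ∀ τ ∈ T K, 0 ≤ shA K t τ)
    (hshB : ∀ τ ∈ T K, 0 ≤ shB K t τ) (hshB' : ∀ τ ∈ T K, shB K t τ ≤ B K t τ)
    (hbadA : ∑ τ ∈ Bad K t, A K t τ ≤ W K * ∑ τ ∈ T K, A K t τ)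
    (hshAsum : ∑ τ ∈ T K, shA K t τ ≤ Wsh K * ∑ τ ∈ T K, A K t τ)
    (hcore : ∀ τ ∈ T K \ Bad K t, m * (A K t τ - shA K t τ) ≤ B K t τ - shB K t τ) :
    m * (∑ τ ∈ S, A K t τ - (W K + Wsh K) * ∑ τ ∈ T K, A K t τ) ≤ ∑ τ ∈ S, B K t τ := by
  have hsub : S \ Bad K t ⊆ T K := sdiff_subset.trans hS
  -- run A: the set `S` is covered by its good part and the bad class
  have h1 : ∑ τ ∈ S, A K t τ ≤ ∑ τ ∈ S \ Bad K t, A K t τ + ∑ τ ∈ Bad K t, A K t τ := by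
    calc ∑ τ ∈ S, A K t τ ≤ ∑ τ ∈ S \ Bad K t ∪ Bad K t, A K t τ :=
          sum_le_sum_of_subset_of_nonneg
            (by intro τ hτ; rw [sdiff_union_self_eq_union]; exact mem_union_left _ hτ)
            (fun τ hτ _ => hA τ (by
              rcases mem_union.1 hτ with h | h
              · exact hsub h
              · exact hBad h))
      _ = ∑ τ ∈ S \ Bad K t, A K t τ + ∑ τ ∈ Bad K t, A K t τ := sum_union sdiff_disjoint
  -- the good part splits into cores and shells; the shells are dominated by the total shell part
  have h2 : ∑ τ ∈ S \ Bad K t, A K t τ =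
      ∑ τ ∈ S \ Bad K t, (A K t τ - shA K t τ) + ∑ τ ∈ S \ Bad K t, shA K t τ := by
    rw [← sum_add_distrib]
    exact sum_congr rfl fun τ _ => by ring
  have h3 : ∑ τ ∈ S \ Bad K t, shA K t τ ≤ ∑ τ ∈ T K, shA K t τ :=
    sum_le_sum_of_subset_of_nonneg hsub fun τ hτ _ => hshA τ hτ
  -- run B: the set `S` carries at least its good cores
  have h4 : ∑ τ ∈ S \ Bad K t, (B K t τ - shB K t τ) ≤ ∑ τ ∈ S, B K t τ := by
    calc ∑ τ ∈ S \ Bad K t, (B K t τ - shB K t τ) ≤ ∑ τ ∈ S \ Bad K t, B K t τ :=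
          sum_le_sum fun τ hτ => sub_le_self _ (hshB τ (hsub hτ))
      _ ≤ ∑ τ ∈ S, B K t τ :=
          sum_le_sum_of_subset_of_nonneg sdiff_subset fun τ hτ _ => (hshB τ (hS hτ)).trans (hshB' τ (hS hτ))
  -- the core sandwich on the good part of `S`
  have h5 : m * ∑ τ ∈ S \ Bad K t, (A K t τ - shA K t τ) ≤ ∑ τ ∈ S \ Bad K t, (B K t τ - shB K t τ) := by
    rw [mul_sum]
    exact sum_le_sum fun τ hτ => hcore τ (sdiff_subset_sdiff hS Subset.rfl hτ)
  have h6 : ∑ τ ∈ S, A K t τ - (W K + Wsh K) * ∑ τ ∈ T K, A K t τ ≤ ∑ τ ∈ S \ Bad K t, (A K t τ - shA K t τ) := by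
    nlinarith [h1, h2, h3, hbadA, hshAsum]
  calc m * (∑ τ ∈ S, A K t τ - (W K + Wsh K) * ∑ τ ∈ T K, A K t τ)
      ≤ m * ∑ τ ∈ S \ Bad K t, (A K t τ - shA K t τ) := mul_le_mul_of_nonneg_left h6 hm
    _ ≤ ∑ τ ∈ S, B K t τ := h5.trans h4

end OneStep

/-! ## §2 The across-class total-variation budget of the hybrid binder list [folklore] -/

section Budget
variable [DecidableEq ι]
/-- The core sandwich of `HybridNE7` at `(K, t)`, WIDENED to the nonnegative radius `|vol·δ_K|` and read as the two one-sided transports §1 consumes: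
`e^{c − |vol·δ_K|}·(A − shA) ≤ B − shB` and `(e^{c + |vol·δ_K|})⁻¹·(B − shB) ≤ A − shA` on the good classes. [folklore] -/
theorem exists_transports_of_hybridNE7 (h : HybridNE7 l₀ vol T A B Bad W shA shB Wsh δ) (K : ℕ) :
    ∃ c : ℝ, ∀ t : ℝ, |t| ≤ l₀ → ∀ τ ∈ T K \ Bad K t,
      Real.exp (c - |vol * δ K|) * (A K t τ - shA K t τ) ≤ B K t τ - shB K t τ ∧
        (Real.exp (c + |vol * δ K|))⁻¹ * (B K t τ - shB K t τ) ≤ A K t τ - shA K t τ := by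
  obtain ⟨c, hc⟩ := h.core K
  refine ⟨c, fun t ht τ hτ => ?_⟩
  have hτT : τ ∈ T K := sdiff_subset hτ
  have hcoreA : 0 ≤ A K t τ - shA K t τ := sub_nonneg.2 (h.shell.sh_le_left K t ht τ hτT)
  obtain ⟨hlo, hhi⟩ := hc t ht τ hτ
  refine ⟨?_, ?_⟩
  · calc Real.exp (c - |vol * δ K|) * (A K t τ - shA K t τ)
        ≤ Real.exp (c - vol * δ K) * (A K t τ - shA K t τ) :=
          mul_le_mul_of_nonneg_right (Real.exp_le_exp.2 (by linarith [le_abs_self (vol * δ K)])) hcoreA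
      _ ≤ B K t τ - shB K t τ := hlo
  · have hU : 0 < Real.exp (c + |vol * δ K|) := Real.exp_pos _
    rw [inv_mul_le_iff₀ hU]
    calc B K t τ - shB K t τ ≤ Real.exp (c + vol * δ K) * (A K t τ - shA K t τ) := hhi
      _ ≤ Real.exp (c + |vol * δ K|) * (A K t τ - shA K t τ) :=
          mul_le_mul_of_nonneg_right (Real.exp_le_exp.2 (by linarith [le_abs_self (vol * δ K)])) hcoreA

/-- **THE ONE-SIDED BUDGET** [folklore].  `HybridNE7 …` ⇒ at every admissible source value, for every `S ⊆ T K` (positive totals):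
`Σ_S A ∕ Σ_T A − Σ_S B ∕ Σ_T B ≤ 2·(W_K + Wsh_K) + 2·|vol·δ_K|`. -/
theorem classLaw_sub_classLaw_le_of_hybridNE7 (h : HybridNE7 l₀ vol T A B Bad W shA shB Wsh δ) (K : ℕ) {t : ℝ} (ht : |t| ≤ l₀)
    (hZA : 0 < ∑ τ ∈ T K, A K t τ) (hZB : 0 < ∑ τ ∈ T K, B K t τ) {S : Finset ι} (hS : S ⊆ T K) :
    (∑ τ ∈ S, A K t τ) / (∑ τ ∈ T K, A K t τ) - (∑ τ ∈ S, B K t τ) / (∑ τ ∈ T K, B K t τ)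
      ≤ 2 * (W K + Wsh K) + 2 * |vol * δ K| := by
  set ZA := ∑ τ ∈ T K, A K t τ with hZAdef
  set ZB := ∑ τ ∈ T K, B K t τ with hZBdef
  set a := ∑ τ ∈ S, A K t τ with hadef
  set b := ∑ τ ∈ S, B K t τ with hbdef
  set η := W K + Wsh K with hηdef
  set x := |vol * δ K| with hxdef
  have hη0 : 0 ≤ η := add_nonneg (h.weight.nonneg K) (h.shell.nonneg K)
  have hη1 : η < 1 := h.lt_one K
  have hx : 0 ≤ x := abs_nonneg _
  obtain ⟨c, hc⟩ := exists_transports_of_hybridNE7 h K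
  have hBad : Bad K t ⊆ T K := h.weight.bad_subset K t ht
  have hshA0 : ∀ τ ∈ T K, 0 ≤ shA K t τ := h.shell.sh_nonneg_left K t ht
  have hshB0 : ∀ τ ∈ T K, 0 ≤ shB K t τ := h.shell.sh_nonneg_right K t ht
  have hshA1 : ∀ τ ∈ T K, shA K t τ ≤ A K t τ := h.shell.sh_le_left K t ht
  have hshB1 : ∀ τ ∈ T K, shB K t τ ≤ B K t τ := h.shell.sh_le_right K t ht
  have hA0 : ∀ τ ∈ T K, 0 ≤ A K t τ := fun τ hτ => (hshA0 τ hτ).trans (hshA1 τ hτ)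
  have hB0 : ∀ τ ∈ T K, 0 ≤ B K t τ := fun τ hτ => (hshB0 τ hτ).trans (hshB1 τ hτ)
  -- (i) run A → run B on `S`, multiplier `L = e^{c − x}`
  have hi : Real.exp (c - x) * (a - η * ZA) ≤ b :=
    mul_sub_le_sum_of_goodCores (Real.exp_pos _).le hS hBad hA0 hshA0 hshB0 hshB1 (h.weight.bad_left K t ht)
      (h.shell.left K t ht) (fun τ hτ => (hc t ht τ hτ).1)
  -- (ii) run B → run A on the whole of `T K`, multiplier `U⁻¹ = (e^{c + x})⁻¹`
  have hii : (Real.exp (c + x))⁻¹ * (ZB - η * ZB) ≤ ZA := by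
    have := mul_sub_le_sum_of_goodCores (A := B) (B := A) (shA := shB) (shB := shA) (W := W) (Wsh := Wsh)
      (inv_nonneg.2 (Real.exp_pos (c + x)).le) Subset.rfl hBad hB0 hshB0 hshA0 hshA1 (h.weight.bad_right K t ht)
      (h.shell.right K t ht) (fun τ hτ => (hc t ht τ hτ).2)
    simpa [hηdef] using this
  have hU : 0 < Real.exp (c + x) := Real.exp_pos _
  -- the totals pin the constant: `(1 − η)·ZB ≤ e^{c + x}·ZA`
  have htot : (1 - η) * ZB ≤ Real.exp (c + x) * ZA := by
    have h' : (1 - η) * ZB = Real.exp (c + x) * ((Real.exp (c + x))⁻¹ * (ZB - η * ZB)) := by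
      rw [← mul_assoc, mul_inv_cancel₀ hU.ne', one_mul]
      ring
    rw [h']
    exact mul_le_mul_of_nonneg_left hii hU.le
  -- `L = U·e^{−2x}`
  have hLU : Real.exp (c - x) = Real.exp (c + x) * Real.exp (-(2 * x)) := by
    rw [← Real.exp_add]
    congr 1
    ring
  set E := Real.exp (-(2 * x)) with hEdef
  have hE0 : 0 < E := Real.exp_pos _
  have hE1 : E ≤ 1 := by
    rw [hEdef, Real.exp_le_one_iff]
    linarith
  set m := (1 - η) * E with hmdef
  have hm0 : 0 ≤ m := mul_nonneg (by linarith) hE0.le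
  have hm1 : m ≤ 1 := by
    calc m = (1 - η) * E := rfl
      _ ≤ 1 * 1 := mul_le_mul (by linarith) hE1 hE0.le zero_le_one
      _ = 1 := one_mul 1
  -- the transported inequality in law letters: `m·(a∕ZA − η) ≤ b∕ZB`
  have hq : m * (a / ZA - η) ≤ b / ZB := by
    rw [le_div_iff₀ hZB]
    rcases le_or_gt (a - η * ZA) 0 with hneg | hpos
    · -- `a∕ZA ≤ η`: the left side is nonpositive, `b ≥ 0`
      have hb0 : 0 ≤ b := sum_nonneg fun τ hτ => hB0 τ (hS hτ)
      have : a / ZA - η ≤ 0 := by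
        rw [sub_nonpos, div_le_iff₀ hZA]
        linarith
      nlinarith [mul_nonneg hm0 hZB.le]
    · have hkey : m * (a / ZA - η) * ZB = ((1 - η) * ZB / ZA) * (E * (a - η * ZA)) := by
        rw [hmdef]
        field_simp
      rw [hkey]
      calc (1 - η) * ZB / ZA * (E * (a - η * ZA))
          ≤ Real.exp (c + x) * (E * (a - η * ZA)) :=
            mul_le_mul_of_nonneg_right ((div_le_iff₀ hZA).2 htot) (mul_nonneg hE0.le hpos.le)
        _ = Real.exp (c - x) * (a - η * ZA) := by rw [hLU]; ring
        _ ≤ b := hi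
  have hp1 : a / ZA ≤ 1 := by
    rw [div_le_one hZA]
    exact sum_le_sum_of_subset_of_nonneg hS fun τ hτ _ => hA0 τ hτ
  exact sub_le_budget_of_mul_sub_le hq hp1 hm1 hη0 (one_sub_mul_exp_neg_le hη0 hη1.le hx)

/-- **★★ THE ACROSS-CLASS TOTAL-VARIATION BUDGET OF THE HYBRID BINDER LIST** [folklore].  `HybridNE7 l₀ vol T A B Bad W shA shB Wsh δ` ⇒ at every
admissible source value `|t| ≤ l₀` with positive totals, for EVERY `S ⊆ T K`,
`|Σ_S A ∕ Σ_T A − Σ_S B ∕ Σ_T B| ≤ 2·(W_K + Wsh_K) + 2·|vol·δ_K|` — the two runs' normalised laws on the class index are close on every set of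
classes, within a budget that is SUMMABLE over `K` (the complement `T K ∖ S` gives the other sign). -/
theorem abs_classLaw_sub_classLaw_le_of_hybridNE7 (h : HybridNE7 l₀ vol T A B Bad W shA shB Wsh δ) (K : ℕ) {t : ℝ} (ht : |t| ≤ l₀)
    (hZA : 0 < ∑ τ ∈ T K, A K t τ) (hZB : 0 < ∑ τ ∈ T K, B K t τ) {S : Finset ι} (hS : S ⊆ T K) :
    |(∑ τ ∈ S, A K t τ) / (∑ τ ∈ T K, A K t τ) - (∑ τ ∈ S, B K t τ) / (∑ τ ∈ T K, B K t τ)|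
      ≤ 2 * (W K + Wsh K) + 2 * |vol * δ K| := by
  rw [abs_sub_le_iff]
  refine ⟨classLaw_sub_classLaw_le_of_hybridNE7 h K ht hZA hZB hS, ?_⟩
  have hc := classLaw_sub_classLaw_le_of_hybridNE7 h K ht hZA hZB (sdiff_subset (s := T K) (t := S))
  rw [sum_sdiff_eq_sub hS, sum_sdiff_eq_sub hS, sub_div, sub_div, div_self hZA.ne', div_self hZB.ne'] at hc
  linarith

/-- The budget is SUMMABLE over the number of steps, for every admissible choice of the dials. [folklore] -/
theorem summable_budget_of_hybridNE7 (h : HybridNE7 l₀ vol T A B Bad W shA shB Wsh δ) :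
    Summable fun K => 2 * (W K + Wsh K) + 2 * |vol * δ K| :=
  ((h.weight.summable.add h.shell.summable).mul_left 2).add ((h.summable.mul_left vol).abs.mul_left 2)

end Budget

/-! ## §3 The disprover's handle with EVERY dial free: an unsummable class-law gap at the key excludes `HybridNE7` for all `Bad, W, shA, shB, Wsh, δ` -/

section Handle
variable [DecidableEq ι]
/-- **★★ KERNEL GUARD, ALL SIX DIALS FREE** [folklore].  If at every level `K` some admissible source value (positive totals) and some set of classes
`S ⊆ T K` exhibit a two-run class-law gap `|Σ_S A ∕ Σ_T A − Σ_S B ∕ Σ_T B| ≥ g_K ≥ 0` with `g` NOT summable, then at the key `(T, A, B)` there is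
NO bad-class family, NO weight budget, NO shell split, NO shell budget and NO radius (hence no core constants either) with
`HybridNE7 l₀ vol T A B Bad W shA shB Wsh δ`.  (A statement about ONE key; in K3⁷ v5 the key is what `PinnedAtLive` pins.) -/
theorem not_exists_hybridNE7_of_unsummable_classLawGap {g : ℕ → ℝ} (hg0 : ∀ K, 0 ≤ g K) (hg : ¬ Summable g)
    (hgap : ∀ K : ℕ, ∃ t : ℝ, |t| ≤ l₀ ∧ 0 < ∑ τ ∈ T K, A K t τ ∧ 0 < ∑ τ ∈ T K, B K t τ ∧ ∃ S ⊆ T K,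
      g K ≤ |(∑ τ ∈ S, A K t τ) / (∑ τ ∈ T K, A K t τ) - (∑ τ ∈ S, B K t τ) / (∑ τ ∈ T K, B K t τ)|) :
    ¬ ∃ (Bad : ℕ → ℝ → Finset ι) (W : ℕ → ℝ) (shA shB : ℕ → ℝ → ι → ℝ) (Wsh δ : ℕ → ℝ),
      HybridNE7 l₀ vol T A B Bad W shA shB Wsh δ := by
  rintro ⟨Bad, W, shA, shB, Wsh, δ, h⟩
  refine hg (Summable.of_nonneg_of_le hg0 (fun K => ?_) (summable_budget_of_hybridNE7 h))
  obtain ⟨t, ht, hZA, hZB, S, hS, hle⟩ := hgap K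
  exact hle.trans (abs_classLaw_sub_classLaw_le_of_hybridNE7 h K ht hZA hZB hS)

/-- The EVENTUAL form [folklore]: the class-law gap need only be exhibited for all large `K` (summability ignores finitely many levels). -/
theorem not_exists_hybridNE7_of_eventually_classLawGap {g : ℕ → ℝ} (hg0 : ∀ K, 0 ≤ g K) (hg : ¬ Summable g)
    (hgap : ∀ᶠ K : ℕ in atTop, ∃ t : ℝ, |t| ≤ l₀ ∧ 0 < ∑ τ ∈ T K, A K t τ ∧ 0 < ∑ τ ∈ T K, B K t τ ∧ ∃ S ⊆ T K,
      g K ≤ |(∑ τ ∈ S, A K t τ) / (∑ τ ∈ T K, A K t τ) - (∑ τ ∈ S, B K t τ) / (∑ τ ∈ T K, B K t τ)|) :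
    ¬ ∃ (Bad : ℕ → ℝ → Finset ι) (W : ℕ → ℝ) (shA shB : ℕ → ℝ → ι → ℝ) (Wsh δ : ℕ → ℝ),
      HybridNE7 l₀ vol T A B Bad W shA shB Wsh δ := by
  rintro ⟨Bad, W, shA, shB, Wsh, δ, h⟩
  obtain ⟨K₀, hK₀⟩ := eventually_atTop.1 hgap
  have hf := summable_budget_of_hybridNE7 h
  have hshift : Summable fun K => g (K + K₀) := by
    refine Summable.of_nonneg_of_le (fun K => hg0 _) (fun K => ?_) ((summable_nat_add_iff K₀).2 hf)
    obtain ⟨t, ht, hZA, hZB, S, hS, hle⟩ := hK₀ (K + K₀) (Nat.le_add_left _ _)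
    exact hle.trans (abs_classLaw_sub_classLaw_le_of_hybridNE7 h (K + K₀) ht hZA hZB hS)
  exact hg ((summable_nat_add_iff K₀).1 hshift)

/-- AT FIXED ADMISSIBLE WEIGHTS AND SHELLS (the N19′ slot's own shape, as in dag-n19-w1's `coreEdge_iff_target_classOsc` ∕ `not_coreEdge_of_unsummable_gap`):
given NE7b's `RelWeightBound … W`, NE7c's `ShellWeightBound … Wsh` and `W + Wsh < 1`, an unsummable class-law gap excludes
`∃ δ, Core … (A − shA) (B − shB) δ ∧ Summable δ`. [folklore] -/
theorem not_coreEdge_of_unsummable_classLawGap (hW : RelWeightBound l₀ T A B Bad W) (hSh : ShellWeightBound l₀ T A B shA shB Wsh)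
    (hlt : ∀ K, W K + Wsh K < 1) {g : ℕ → ℝ} (hg0 : ∀ K, 0 ≤ g K) (hg : ¬ Summable g)
    (hgap : ∀ K : ℕ, ∃ t : ℝ, |t| ≤ l₀ ∧ 0 < ∑ τ ∈ T K, A K t τ ∧ 0 < ∑ τ ∈ T K, B K t τ ∧ ∃ S ⊆ T K,
      g K ≤ |(∑ τ ∈ S, A K t τ) / (∑ τ ∈ T K, A K t τ) - (∑ τ ∈ S, B K t τ) / (∑ τ ∈ T K, B K t τ)|) :
    ¬ ∃ δ : ℕ → ℝ, Core l₀ vol T Bad (fun K t τ => A K t τ - shA K t τ) (fun K t τ => B K t τ - shB K t τ) δ ∧ Summable δ := by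
  rintro ⟨δ, hC, hδ⟩
  exact not_exists_hybridNE7_of_unsummable_classLawGap hg0 hg hgap ⟨Bad, W, shA, shB, Wsh, δ, ⟨hW, hSh, hlt, hδ, hC⟩⟩

end Handle

/-! ## §4 The card's caricature with every dial free: uniform run-A classes vs `e^{D·v}`-tilted run-B classes, `n_K → ∞` [folklore] -/

section Caricature
/-- The tilted total is dominated by its last term: `(1 − e^{−D})·Σ_{v ≤ n} e^{c + D·v} ≤ e^{c + D·n}` for `D ≥ 0` (shift the first `n` terms up by
one step: `Σ_{v < n} e^{c + D·v} = e^{−D}·Σ_{v < n} e^{c + D·(v+1)} ≤ e^{−D}·Σ_{v ≤ n} e^{c + D·v}`). [folklore] -/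
theorem one_sub_exp_neg_mul_sum_le_last (c D : ℝ) (n : ℕ) :
    (1 - Real.exp (-D)) * ∑ v ∈ range (n + 1), Real.exp (c + D * v) ≤ Real.exp (c + D * n) := by
  have hsplit : ∑ v ∈ range (n + 1), Real.exp (c + D * v) = ∑ v ∈ range n, Real.exp (c + D * v) + Real.exp (c + D * n) :=
    sum_range_succ _ n
  have hshift : ∑ v ∈ range n, Real.exp (c + D * v) = Real.exp (-D) * ∑ v ∈ range n, Real.exp (c + D * ((v + 1 : ℕ) : ℝ)) := by
    rw [mul_sum]
    refine sum_congr rfl fun v _ => ?_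
    rw [← Real.exp_add]
    congr 1
    push_cast
    ring
  have hle : ∑ v ∈ range n, Real.exp (c + D * ((v + 1 : ℕ) : ℝ)) ≤ ∑ v ∈ range (n + 1), Real.exp (c + D * v) := by
    rw [sum_range_succ' (fun v => Real.exp (c + D * (v : ℝ))) n]
    exact le_add_of_nonneg_right (Real.exp_pos _).le
  have hE : 0 ≤ Real.exp (-D) := (Real.exp_pos _).le
  nlinarith [mul_le_mul_of_nonneg_left hle hE, hsplit, hshift]

/-- In the caricature the top class `{n}` carries run-B law mass `≥ 1 − e^{−D}` and run-A law mass `1∕(n+1)`: the class-law gap on `S = {n}` is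
`≥ (1 − e^{−D}) − 1∕(n+1)`. [folklore] -/
theorem caricature_classLawGap_top (c D : ℝ) (n : ℕ) :
    (1 - Real.exp (-D)) - 1 / ((n : ℝ) + 1) ≤
      |(∑ _v ∈ ({n} : Finset ℕ), (1 : ℝ)) / (∑ _v ∈ range (n + 1), (1 : ℝ)) -
        (∑ v ∈ ({n} : Finset ℕ), Real.exp (c + D * v)) / (∑ v ∈ range (n + 1), Real.exp (c + D * v))| := by
  have hZB : 0 < ∑ v ∈ range (n + 1), Real.exp (c + D * v) :=
    sum_pos (fun v _ => Real.exp_pos _) ⟨0, by simp⟩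
  have hq : 1 - Real.exp (-D) ≤ Real.exp (c + D * n) / ∑ v ∈ range (n + 1), Real.exp (c + D * v) := by
    rw [le_div_iff₀ hZB]
    exact one_sub_exp_neg_mul_sum_le_last c D n
  have hp : (∑ _v ∈ ({n} : Finset ℕ), (1 : ℝ)) / (∑ _v ∈ range (n + 1), (1 : ℝ)) = 1 / ((n : ℝ) + 1) := by
    simp
  rw [hp, sum_singleton]
  calc (1 - Real.exp (-D)) - 1 / ((n : ℝ) + 1)
      ≤ Real.exp (c + D * n) / (∑ v ∈ range (n + 1), Real.exp (c + D * v)) - 1 / ((n : ℝ) + 1) := by linarith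
    _ ≤ _ := by
        rw [abs_sub_comm]
        exact le_abs_self _

/-- **★★ THE CARICATURE HAS NO WITNESS WITH ANY DIAL** [folklore].  Classes `v ∈ {0, …, n_K}` (old-large-field counts), run-A weights `≡ 1`, run-B weights
`e^{c_K + D·v}` with a per-old-block two-run increment `D > 0`, and `n_K → ∞` (physically `n_K = vol·L^{4(K₀+K−1)}`): for NO bad-class family, weight
budget, shell split, shell budget and radius does `HybridNE7` hold at this reading, at any source radius `l₀ ≥ 0` and any `vol` — the card's
`caricature_not_coreEdge` (no shells, no bad class) survives every dial of K3⁷ v5 stub 2.  (Top class: run-A law mass `1∕(n_K+1) → 0`, run-B law mass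
`≥ 1 − e^{−D}`; §3 with the constant gap `(1 − e^{−D})∕2`.) -/
theorem caricature_not_hybridNE7_allDials (hl₀ : 0 ≤ l₀) (n : ℕ → ℕ) (hn : Tendsto n atTop atTop) (c : ℕ → ℝ) {D : ℝ} (hD : 0 < D) :
    ¬ ∃ (Bad : ℕ → ℝ → Finset ℕ) (W : ℕ → ℝ) (shA shB : ℕ → ℝ → ℕ → ℝ) (Wsh δ : ℕ → ℝ),
      HybridNE7 l₀ vol (fun K => range (n K + 1)) (fun _ _ _ => (1 : ℝ)) (fun K _ v => Real.exp (c K + D * v)) Bad W shA shB Wsh δ := by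
  have hgap0 : 0 < 1 - Real.exp (-D) := by
    have : Real.exp (-D) < 1 := Real.exp_lt_one_iff.2 (by linarith)
    linarith
  set g₀ : ℝ := (1 - Real.exp (-D)) / 2 with hg₀
  have hg₀pos : 0 < g₀ := by positivity
  refine not_exists_hybridNE7_of_eventually_classLawGap (g := fun _ => g₀) (fun _ => hg₀pos.le) ?_ ?_
  · -- a positive constant is not summable
    intro hs
    have h0 := hs.tendsto_atTop_zero
    have : g₀ = 0 := tendsto_nhds_unique tendsto_const_nhds h0
    exact hg₀pos.ne' this
  · -- eventually `1∕(n_K + 1) ≤ g₀`, so the top-class gap is `≥ g₀`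
    obtain ⟨N, hN⟩ := exists_nat_one_div_lt hg₀pos
    have hev : ∀ᶠ K : ℕ in atTop, N ≤ n K := hn.eventually (eventually_ge_atTop N)
    refine hev.mono fun K hK => ⟨0, by simpa using hl₀, ?_, ?_, {n K}, by simp, ?_⟩
    · exact sum_pos (fun _ _ => one_pos) ⟨0, by simp⟩
    · exact sum_pos (fun _ _ => Real.exp_pos _) ⟨0, by simp⟩
    · have hmono : 1 / ((n K : ℝ) + 1) ≤ 1 / ((N : ℝ) + 1) :=
        one_div_le_one_div_of_le (by positivity) (by exact_mod_cast Nat.succ_le_succ hK)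
      have htop := caricature_classLawGap_top (c K) D (n K)
      show g₀ ≤ _
      linarith

end Caricature

end Summit.QuantumFields.YangMills.BalabanUVNodes.N20HybridClassLawBudget

end
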